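import Summits.HodgeConjecture.HodgeConjecture.Theorems.F0LD1ThetaGermDefs
import Summits.HodgeConjecture.HodgeConjecture.Theorems.F0LD1ThetaSliceBricks
import Summits.HodgeConjecture.HodgeConjecture.Theorems.F0LD1ThetaSliceOfBricks
import Summits.HodgeConjecture.HodgeConjecture.Theorems.F0LD1ThetaDichotomyBricks
import Summits.HodgeConjecture.HodgeConjecture.Theorems.F0LD1CharThetaSpaceLeOfIrreducible
import Summits.HodgeConjecture.HodgeConjecture.Theorems.F0LD1ArchTorusHom
import Summits.HodgeConjecture.HodgeConjecture.Theorems.F0LD2ThetaTensorClasses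
import Summits.HodgeConjecture.HodgeConjecture.Theorems.F0LD2FrameTransportPin
import HarnessLib

/-!
# Crux `HLiu418`, line LD1 — organ (Gα) `ThetaDichotomy₂` FROM ITS BRICKS (PROOFS; junction v3, LD1-plan (g2))

Cell hodgecm-mathlib, FLOOR 0, programme-6 line LD1; namespace `Summit.HodgeConjecture.HodgeConjecture.Cruxes.HLiu418.F0LD1ThetaDichotomyOfBricks` (brick
statements in ★∕review `Theorems/F0LD1ThetaDichotomyBricks.lean`, (Gβ) bricks in ★∕review `Theorems/F0LD1ThetaSliceBricks.lean`, Hermite slice datum in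
`Theorems/F0LD1ThetaSliceOfBricks.lean`).  THEOREMS ONLY, sorry-free:

* §1 `dichotomy_of_slice_cyclic` (generic, unitary, ★-free) — `π` unitary, `X` = closure of `V` closed invariant, `E` bounded preserving every closed
  invariant `Q`, `E(V)` finite-dimensional, `E ≠ 0` on `V`, every non-zero vector of `E(V)` CYCLIC for `V` ⟹ `∀ Q, V ≤ Q ∨ V ⊓ Q = ⊥` (inside `X`:
  either `E ≠ 0` on `X ⊓ Q`, or `E` maps `X` into the closed invariant `X ⊓ (X ⊓ Q)ᗮ` and cyclicity empties `X ⊓ Q`).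
* §2 `thetaDichotomy₂_of_bricks` — (Gα) from the four (Gβ) bricks (consumed BY NAME through `exists_hermiteSliceData_of_bricks`: the SAME operator
  `E = P_β ∘ A` and Hermite slice) and (Gα-C) `SliceCyclic`; every vector of the slice is ONE class `[θ^{μ_W}_{h_β ⊗ Φ_f″}]` (linearity in `Φ_f`).
* §3 `sliceCyclic_of_bricks` — (Gα-C) from (Gβ-Σ) `HermiteSum`, (Gβ-M) `MeasureScaling`, (Gα-C∞) `ArchLadder`, (Gα-Cf) `FinGeneration`: Hermite-slice
  classes ∈ `Q` ⟹ pure-tensor classes `[θ_{φ ⊗ Φ_f}] ∈ Q` (L²-convergent Hermite expansion, `Q` closed) ⟹ all `[θ_{φ ⊗ Φ_f′}] ∈ Q` ⟹ all `[θ^{μ_W}_Ψ] ∈ Q`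
  (pure tensors span ★ `piSchwartzBruhatEquiv`, linearity ★ `toLp_lineThetaLift_add_left ∕ _smul_left`) ⟹ all `[θ^{μ_W′}_Ψ] ∈ Q` ((Gβ-M)); and the
  corollary `thetaDichotomy₂_of_localBricks` (the six bricks ⟹ (Gα)).

With `thetaSlice₂_of_bricks` BOTH organs of the (I′) germ road — hence `ThetaSpaceIrreducible₂` and `ThetaCharRigid₂` — rest on six brick-sized LOCAL
statements: no multiplicity one, no spectral decomposition, no abstract operator algebra.
HONEST LABEL: HC_CM is proved only modulo the 7 printed citations (2 remaining: hLiu418 = stmt-HodgeConjecture-24832, h413 =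
stmt-HodgeConjecture-24833) until rung 0 closes; this file discharges nothing printed by itself; count-neutral.

## References
* [Dixmier1977] J. Dixmier, *C*-algebras* (1977), §13.1.2.  [BorelJacquet1979] A. Borel, H. Jacquet, PSPM 33.1 (1979), §4.6.
* [MoeglinVignerasWaldspurger1987] LNM 1291, Chap. 3 IV.4.  [KashiwaraVergne1978] Invent. Math. 44 (1978), §6.  [Flath1979] PSPM 33.1, Thm. 2.
* [Weil1964] A. Weil, Acta Math. 111 (1964), Chap. III n° 41 Thm 6 p. 193.  [Folland1989] G. Folland, *Harmonic analysis in phase space*, Thm. 4.37.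
-/
set_option autoImplicit false
set_option linter.dupNamespace false

noncomputable section

open NumberField NumberField.InfinitePlace MeasureTheory IsDedekindDomain
open scoped Matrix Kronecker ComplexOrder ENNReal TensorProduct SchwartzMap InnerProductSpace ComplexConjugate Classical
open Literature.NumberTheory.Automorphic Literature.NumberTheory.Automorphic.UnitaryGroup
open Literature.NumberTheory.Automorphic.UnitaryGroup.CotangentForms (toQuotFun)
open Literature.NumberTheory.Automorphic.UnitaryCurveForms
open Literature.NumberTheory.Automorphic.Liu2021 Literature.NumberTheory.Automorphic.Liu2021.Def411WeilCarriers
open Literature.NumberTheory.Automorphic.Liu2021.Def411WeilCarriersDoubling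
open Literature.NumberTheory.Automorphic.Liu2021.CinfThetaTorus
open Literature.NumberTheory.GaloisRepresentations Literature.NumberTheory.Automorphic.IdeleClassGroup
open Literature.NumberTheory.GelbartRogawski1991 Literature.NumberTheory.GelbartRogawski1991.UnitaryDualPair
open Literature.NumberTheory.GelbartRogawski1991.UnitaryDualPair.WeilCoinv
open Literature.NumberTheory.GelbartRogawski1991.GRConstruction
open Literature.NumberTheory.Weil1964
open Literature.RepresentationTheory.Liu2021 Literature.RepresentationTheory.HarrisKudlaSweet1996
open Literature.RepresentationTheory.HeisenbergGroup Literature.Analysis.SegalBargmann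
open Literature.RepresentationTheory.KonnoKonno2007 Literature.RepresentationTheory.KonnoKonno2007.RealDualPair
open Literature.RepresentationTheory.CompactGroups
open Literature.NumberTheory.Rogawski1990
open Summit.HodgeConjecture.HodgeConjecture.Cruxes.HLiu418.F0LD1ThetaTransportKit
open Summit.HodgeConjecture.HodgeConjecture.Cruxes.HLiu418.F0LD2ThetaTensorClasses
open Summit.HodgeConjecture.HodgeConjecture.Cruxes.HLiu418.F0LD2FrameTransportPin
open Summit.HodgeConjecture.HodgeConjecture.Cruxes.HLiu418.F0LD1ThetaGermDefs

namespace Summit.HodgeConjecture.HodgeConjecture.Cruxes.HLiu418.F0LD1ThetaDichotomyOfBricks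

open F0LD1ThetaGermDefs F0LD1ThetaSliceOfBricks

section Generic

variable {Y : Type*} [NormedAddCommGroup Y] [InnerProductSpace ℂ Y] [CompleteSpace Y]

set_option maxHeartbeats 800000 in
/-- **Dichotomy from a finite cyclic slice.**  `π` unitary, `V` a subspace with closure the closed invariant `X`, `E` a bounded operator preserving every
closed invariant subspace with `E(V)` finite-dimensional and `E ≠ 0` on `V`; if every non-zero vector of the slice `E(V)` is CYCLIC for `V` (a closed invariant
subspace containing it contains `V`), then every closed invariant `Q` contains `V` or meets it trivially.  Proof: `E` maps `X` into the closed slice `E(V)`;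
if `E ≠ 0` on `X ⊓ Q`, a non-zero slice vector lies in `X ⊓ Q`; else `E` maps `X` into the closed invariant `X ⊓ (X ⊓ Q)ᗮ`, which then contains `V`, hence `X`,
forcing `X ⊓ Q = 0`.  [cite: Dixmier1977, §13.1.2] -/
theorem dichotomy_of_slice_cyclic {G : Type*} [Group G] {π : ContRepresentation ℂ G Y} (hπ : π.IsUnitary)
    (V : Submodule ℂ Y) (X : ContRepresentation.ClosedSubrep π) (hX : (X.toSubmodule : Set Y) = closure (V : Set Y))
    (E : Y →L[ℂ] Y) (hEQ : ∀ Q : ContRepresentation.ClosedSubrep π, ∀ v ∈ Q, E v ∈ Q)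
    (hF : FiniteDimensional ℂ ↥(V.map E.toLinearMap))
    (hcyc : ∀ f ∈ V.map E.toLinearMap, f ≠ 0 → ∀ Q : ContRepresentation.ClosedSubrep π, f ∈ Q → V ≤ Q.toSubmodule)
    (hne : ∃ w ∈ V, E w ≠ 0) (Q : ContRepresentation.ClosedSubrep π) :
    V ≤ Q.toSubmodule ∨ V ⊓ Q.toSubmodule = ⊥ := by
  haveI := hF
  -- `V ≤ X`
  have hVX : V ≤ X.toSubmodule := fun v hv => by
    have h' : v ∈ (X.toSubmodule : Set Y) := by
      rw [hX]
      exact subset_closure hv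
    exact h'
  -- `E` maps `X` into the closed, finite-dimensional slice `E(V)`
  have hEX : ∀ x ∈ X.toSubmodule, E x ∈ V.map E.toLinearMap := by
    intro x hx
    have hx' : x ∈ closure (V : Set Y) := by
      rw [← hX]
      exact hx
    have h1 : E x ∈ closure ((V.map E.toLinearMap : Submodule ℂ Y) : Set Y) := by
      refine closure_mono ?_ (image_closure_subset_closure_image E.continuous ⟨x, hx', rfl⟩)
      rintro _ ⟨v, hv, rfl⟩
      exact ⟨v, hv, rfl⟩
    rwa [(Submodule.closed_of_finiteDimensional (V.map E.toLinearMap)).closure_eq] at h1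
  -- the closed invariant subspace `X ⊓ Q`
  let QX : ContRepresentation.ClosedSubrep π := ⟨X.toSubrepresentation ⊓ Q.toSubrepresentation, X.isClosed.inter Q.isClosed⟩
  have hmemQX : ∀ v, v ∈ QX ↔ v ∈ X.toSubmodule ∧ v ∈ Q.toSubmodule := fun v => Iff.rfl
  by_cases hcase : ∃ q ∈ QX, E q ≠ 0
  · -- a non-zero slice vector inside `X ⊓ Q`: cyclicity
    obtain ⟨q, hq, hq0⟩ := hcase
    exact Or.inl (le_trans (hcyc (E q) (hEX q ((hmemQX q).1 hq).1) hq0 QX (hEQ QX q hq)) fun v hv => ((hmemQX v).1 hv).2)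
  · -- `E` kills `X ⊓ Q`
    push Not at hcase
    let Q' : ContRepresentation.ClosedSubrep π :=
      ⟨X.toSubrepresentation ⊓ (QX.orthogonal hπ).toSubrepresentation, X.isClosed.inter (QX.orthogonal hπ).isClosed⟩
    have hmemQ' : ∀ v, v ∈ Q' ↔ v ∈ X.toSubmodule ∧ v ∈ QX.toSubmoduleᗮ := fun v => Iff.rfl
    obtain ⟨w, hw, hw0⟩ := hne
    have hwX : w ∈ X.toSubmodule := hVX hw
    haveI : CompleteSpace QX.toSubmodule := QX.isClosed.completeSpace_coe
    haveI : QX.toSubmodule.HasOrthogonalProjection := .ofCompleteSpace _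
    have hqQX : QX.toSubmodule.starProjection w ∈ QX := QX.toSubmodule.starProjection_apply_mem w
    have hq' : w - QX.toSubmodule.starProjection w ∈ QX.toSubmoduleᗮ := QX.toSubmodule.sub_starProjection_mem_orthogonal w
    have hEw : E w = E (w - QX.toSubmodule.starProjection w) := by
      rw [map_sub, hcase _ hqQX, sub_zero]
    have hwq : w - QX.toSubmodule.starProjection w ∈ Q' :=
      (hmemQ' _).2 ⟨X.toSubmodule.sub_mem hwX ((hmemQX _).1 hqQX).1, hq'⟩
    have hEwQ' : E w ∈ Q' := by
      rw [hEw]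
      exact hEQ Q' _ hwq
    have hVQ' : V ≤ Q'.toSubmodule := hcyc (E w) ⟨w, hw, rfl⟩ hw0 Q' hEwQ'
    have hXQ' : X.toSubmodule ≤ Q'.toSubmodule := by
      intro x hx
      have hx' : x ∈ closure (V : Set Y) := by
        rw [← hX]
        exact hx
      exact (Q'.isClosed.closure_subset_iff.2 fun v hv => hVQ' hv) hx'
    refine Or.inr (eq_bot_iff.2 fun v hv => ?_)
    have hv1 : v ∈ V := (Submodule.mem_inf.1 hv).1
    have hv2 : v ∈ Q.toSubmodule := (Submodule.mem_inf.1 hv).2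
    have hvQX : v ∈ QX.toSubmodule := (hmemQX v).2 ⟨hVX hv1, hv2⟩
    have hvorth : v ∈ QX.toSubmoduleᗮ := ((hmemQ' v).1 (hXQ' (hVX hv1))).2
    have hmem : v ∈ QX.toSubmodule ⊓ QX.toSubmoduleᗮ := Submodule.mem_inf.2 ⟨hvQX, hvorth⟩
    rw [Submodule.inf_orthogonal_eq_bot] at hmem
    exact hmem

end Generic

/-! ## §2 The junction: `ThetaDichotomy₂` from the four (Gβ) bricks and `SliceCyclic` (sorry-free) -/

set_option maxHeartbeats 1600000 in
/-- **ORGAN (Gα) FROM THE FOUR (Gβ) BRICKS AND (Gα-C).**  The Hermite slice datum `(A, P_β, hρ, μ_W, β, S)` of ★ `exists_hermiteSliceData_of_bricks` gives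
`E := P_β ∘ A` with `E(span 𝒞) ≤ F = span {[θ^{μ_W}_{h_β ⊗ Φ_f′}] : Φ_f′ ∈ S}` finite-dimensional; every vector of `F` is ONE Hermite-slice class
`[θ^{μ_W}_{h_β ⊗ Φ_f″}]` (linearity in `Φ_f`), so (Gα-C) makes every non-zero slice vector cyclic; §1 at the closed theta span
(★ `exists_closedSubrep_thetaSpan`, ★ `isUnitary_rightRegular`). [cite: Dixmier1977, §13.1.2] [cite: MoeglinVignerasWaldspurger1987, Chap. 3 IV.4] -/
theorem thetaDichotomy₂_of_bricks (hHS : HermiteSum) (hP : TorusProjector) (hL : FiniteLevel) (hM : MeasureScaling) (hC : SliceCyclic) :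
    ThetaDichotomy₂ := by
  intro L _ _ _ ι H dV hdV hdV0 t ht g hg hsig hdef hdeg μ _ n' e₁ lam hlam hw ιA hιA _ a' ξ Q
  letI : MeasurableSpace (↥(UnitaryGroup.adelic (↥(maximalRealSubfield L)) L (IsCMField.complexConj L) 1 (JW (↥(maximalRealSubfield L)) L a')) ⧸ (UnitaryGroup.toAdelic (↥(maximalRealSubfield L)) L (IsCMField.complexConj L) 1 (JW (↥(maximalRealSubfield L)) L a')).range) := borel _
  haveI : BorelSpace (↥(UnitaryGroup.adelic (↥(maximalRealSubfield L)) L (IsCMField.complexConj L) 1 (JW (↥(maximalRealSubfield L)) L a')) ⧸ (UnitaryGroup.toAdelic (↥(maximalRealSubfield L)) L (IsCMField.complexConj L) 1 (JW (↥(maximalRealSubfield L)) L a')).range) := ⟨rfl⟩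
  haveI hN := normal_range_toAdelic_JW L a'
  haveI : CompactSpace (adelicGroupData (↥(maximalRealSubfield L)) L (IsCMField.complexConj L) 2 H).automorphicQuotient := by
    obtain ⟨τ, hτ⟩ := UnitaryGroup.exists_infinitePlace_ne L hdeg ι
    exact UnitaryGroup.compactSpace_adelicGroupData_automorphicQuotient L 2 H
      (UnitaryGroup.anisotropic_of_formCongr_smul_eq_of_posDef L 2 H dV t ht g hg τ (hdef τ hτ))
  have hT : Continuous ιA ∧ ∀ ⦃γ : (adelicGroupData (↥(maximalRealSubfield L)) L (IsCMField.complexConj L) 2 H).Adelic⦄,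
      γ ∈ (UnitaryGroup.toAdelic (↥(maximalRealSubfield L)) L (IsCMField.complexConj L) 2 H).range →
        ιA γ ∈ (UnitaryGroup.toAdelic (↥(maximalRealSubfield L)) L (IsCMField.complexConj L) 2 (Matrix.diagonal dV)).range :=
    ⟨continuous_of_pin L 2 H dV g ιA hιA, fun γ hγ => mem_range_toAdelic_of_pin L 2 H dV t ht g hg ιA hιA hγ⟩
  by_cases hbot : Submodule.span ℂ (lineThetaClassSet L 2 H e₁ dV hdV hdV0 ιA μ lam hlam a' ξ) = ⊥
  · refine Or.inr ?_
    rw [hbot]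
    exact bot_inf_eq _
  obtain ⟨A, P, hρ, μW, hfin, hinv, β, S, Φf, hAQ, hPQ, -, hFβ, hgen, -, hfix, hw0⟩ :=
    exists_hermiteSliceData_of_bricks hHS hP hL hM L ι H dV hdV hdV0 t ht g hg hsig hdef hdeg μ e₁ lam hlam hw ιA hιA a' ξ hbot
  haveI := hfin
  haveI := hinv
  haveI := hFβ
  -- the closed invariant theta span
  obtain ⟨X, -, hXcl⟩ :=
    F0LD1CharThetaSpaceLeOfIrreducible.exists_closedSubrep_thetaSpan (μA := μ) L 2 H e₁ dV hdV hdV0 t ht g hg ιA hιA lam hlam a' ξ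
  -- the slice `E(span) ≤ F`
  have hmap : (Submodule.span ℂ (lineThetaClassSet L 2 H e₁ dV hdV hdV0 ιA μ lam hlam a' ξ)).map (P ∘L A).toLinearMap ≤ Submodule.span ℂ {v : ((adelicGroupData (↥(maximalRealSubfield L)) L (IsCMField.complexConj L) 2 H).L2 μ) | ∃ Φf' : FinSB (↥(maximalRealSubfield L)) (Fin n'), Φf' ∈ S ∧
              v = MemLp.toLp _ (memLp_toQuotFun_lineThetaLift L 2 H e₁ dV hdV hdV0 ιA hT lam hlam a' hρ μW
            (piSchwartzBruhatEquiv (↥(maximalRealSubfield L)) (Fin n') (follandHermite (frameV L e₁ dV hdV hdV0 (lineW L (TW (Fp L) a')) (complexConj_lineW L (TW (Fp L) a'))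
                (lineW_ne_zero L (TW (Fp L) a') (isUnit_det_TW (Fp L) a'))) β ⊗ₜ[ℂ] Φf')) (charCM ξ) μ 2)} :=
    map_span_le_of_forall_mem _ (P ∘L A).toLinearMap _ (fun c hc => hgen c hc)
  -- every vector of `F` is ONE Hermite-slice class (linearity in `Φ_f`)
  have hone : ∀ f ∈ Submodule.span ℂ {v : ((adelicGroupData (↥(maximalRealSubfield L)) L (IsCMField.complexConj L) 2 H).L2 μ) | ∃ Φf' : FinSB (↥(maximalRealSubfield L)) (Fin n'), Φf' ∈ S ∧
              v = MemLp.toLp _ (memLp_toQuotFun_lineThetaLift L 2 H e₁ dV hdV hdV0 ιA hT lam hlam a' hρ μW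
            (piSchwartzBruhatEquiv (↥(maximalRealSubfield L)) (Fin n') (follandHermite (frameV L e₁ dV hdV hdV0 (lineW L (TW (Fp L) a')) (complexConj_lineW L (TW (Fp L) a'))
                (lineW_ne_zero L (TW (Fp L) a') (isUnit_det_TW (Fp L) a'))) β ⊗ₜ[ℂ] Φf')) (charCM ξ) μ 2)}, ∃ Φf'' : FinSB (↥(maximalRealSubfield L)) (Fin n'),
      f = MemLp.toLp _ (memLp_toQuotFun_lineThetaLift L 2 H e₁ dV hdV hdV0 ιA hT lam hlam a' hρ μW
            (piSchwartzBruhatEquiv (↥(maximalRealSubfield L)) (Fin n') (follandHermite (frameV L e₁ dV hdV hdV0 (lineW L (TW (Fp L) a')) (complexConj_lineW L (TW (Fp L) a'))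
                (lineW_ne_zero L (TW (Fp L) a') (isUnit_det_TW (Fp L) a'))) β ⊗ₜ[ℂ] Φf'')) (charCM ξ) μ 2) := by
    intro f hf
    induction hf using Submodule.span_induction with
    | mem x hx =>
      obtain ⟨Φf', -, rfl⟩ := hx
      exact ⟨Φf', rfl⟩
    | zero =>
      refine ⟨0, ?_⟩
      rw [toLp_lineThetaLift_congr L 2 H e₁ dV hdV hdV0 ιA hT lam hlam a' hρ μW (charCM ξ) μ
        (show piSchwartzBruhatEquiv (↥(maximalRealSubfield L)) (Fin n') (follandHermite (frameV L e₁ dV hdV hdV0 (lineW L (TW (Fp L) a')) (complexConj_lineW L (TW (Fp L) a'))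
                (lineW_ne_zero L (TW (Fp L) a') (isUnit_det_TW (Fp L) a'))) β ⊗ₜ[ℂ] (0 : FinSB (↥(maximalRealSubfield L)) (Fin n'))) = (0 : ℂ) • piSchwartzBruhatEquiv (↥(maximalRealSubfield L)) (Fin n') (follandHermite (frameV L e₁ dV hdV hdV0 (lineW L (TW (Fp L) a')) (complexConj_lineW L (TW (Fp L) a'))
                (lineW_ne_zero L (TW (Fp L) a') (isUnit_det_TW (Fp L) a'))) β ⊗ₜ[ℂ] (0 : FinSB (↥(maximalRealSubfield L)) (Fin n'))) by rw [TensorProduct.tmul_zero, map_zero, smul_zero]),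
        F0LD2ThetaTensorClasses.toLp_lineThetaLift_smul_left (hιA := hT), zero_smul]
    | add x y _ _ hx hy =>
      obtain ⟨Φ₁, rfl⟩ := hx
      obtain ⟨Φ₂, rfl⟩ := hy
      refine ⟨Φ₁ + Φ₂, ?_⟩
      rw [← F0LD2ThetaTensorClasses.toLp_lineThetaLift_add_left (hιA := hT)]
      exact toLp_lineThetaLift_congr L 2 H e₁ dV hdV hdV0 ιA hT lam hlam a' hρ μW (charCM ξ) μ (by rw [TensorProduct.tmul_add, map_add])
    | smul c x _ hx =>
      obtain ⟨Φ₁, rfl⟩ := hx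
      refine ⟨c • Φ₁, ?_⟩
      rw [← F0LD2ThetaTensorClasses.toLp_lineThetaLift_smul_left (hιA := hT)]
      exact toLp_lineThetaLift_congr L 2 H e₁ dV hdV hdV0 ιA hT lam hlam a' hρ μW (charCM ξ) μ (by rw [TensorProduct.tmul_smul, map_smul])
  refine dichotomy_of_slice_cyclic
    ((adelicGroupData (↥(maximalRealSubfield L)) L (IsCMField.complexConj L) 2 H).isUnitary_rightRegular μ)
    (Submodule.span ℂ (lineThetaClassSet L 2 H e₁ dV hdV hdV0 ιA μ lam hlam a' ξ)) X hXcl (P ∘L A) (fun Q v hv => hPQ Q _ (hAQ Q v hv))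
    (Submodule.finiteDimensional_of_le hmap) ?_
    ⟨_, Submodule.subset_span ⟨hρ, μW, hfin, hinv, _, _, rfl⟩, by rw [ContinuousLinearMap.comp_apply, hfix]; exact hw0⟩ Q
  -- cyclicity of every non-zero slice vector, by (Gα-C)
  intro f hf hf0 Q' hfQ'
  obtain ⟨Φf'', hfeq⟩ := hone f (hmap hf)
  rw [hfeq] at hf0 hfQ'
  refine Submodule.span_le.2 ?_
  rintro c ⟨hρ', μW', hfin', hinv', Ψ', hθ', rfl⟩
  haveI := hfin'
  haveI := hinv'
  exact hC L ι H dV hdV hdV0 t ht g hg hsig hdef hdeg μ e₁ lam hlam hw ιA hιA a' ξ hρ μW β Φf'' hf0 Q' hfQ' hρ' μW' Ψ'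

/-! ## §3 (Gα-C) `SliceCyclic` from its bricks; (Gα) from the six local bricks -/

set_option maxHeartbeats 1600000 in
/-- **(Gα-C) FROM ITS BRICKS.**  `SliceCyclic ⇐ HermiteSum → MeasureScaling → ArchLadder → FinGeneration`, sorry-free: all Hermite-slice classes
`[θ_{h_β′ ⊗ Φ_f}]` lie in `Q` (C∞); hence every `[θ_{φ ⊗ Φ_f}]` (L²-convergent Hermite expansion (Gβ-Σ), `Q` closed); hence every `[θ_{φ ⊗ Φ_f′}]` (Cf);
hence every `[θ^{μ_W}_Ψ]` (pure tensors span ★ `piSchwartzBruhatEquiv`, linearity ★ `toLp_lineThetaLift_add_left ∕ _smul_left`); hence every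
`[θ^{μ_W′}_Ψ]` ((Gβ-M), witness `w ≠ 0`). [cite: Weil1964, Chap. III n° 41 Thm 6 p. 193] [cite: MoeglinVignerasWaldspurger1987, Chap. 3 IV.4] -/
theorem sliceCyclic_of_bricks (hHS : HermiteSum) (hM : MeasureScaling) (hAL : ArchLadder) (hFG : FinGeneration) : SliceCyclic := by
  intro L _ _ _ ι H dV hdV hdV0 t ht g hg hsig hdef hdeg μ _ n' e₁ lam hlam hw ιA hιA _ a' ξ hρ μW _ _ β Φf hw0 Q hwQ hρ' μW' _ _ Ψ
  letI : MeasurableSpace (↥(UnitaryGroup.adelic (↥(maximalRealSubfield L)) L (IsCMField.complexConj L) 1 (JW (↥(maximalRealSubfield L)) L a')) ⧸ (UnitaryGroup.toAdelic (↥(maximalRealSubfield L)) L (IsCMField.complexConj L) 1 (JW (↥(maximalRealSubfield L)) L a')).range) := borel _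
  haveI : BorelSpace (↥(UnitaryGroup.adelic (↥(maximalRealSubfield L)) L (IsCMField.complexConj L) 1 (JW (↥(maximalRealSubfield L)) L a')) ⧸ (UnitaryGroup.toAdelic (↥(maximalRealSubfield L)) L (IsCMField.complexConj L) 1 (JW (↥(maximalRealSubfield L)) L a')).range) := ⟨rfl⟩
  haveI hN := normal_range_toAdelic_JW L a'
  haveI : CompactSpace (adelicGroupData (↥(maximalRealSubfield L)) L (IsCMField.complexConj L) 2 H).automorphicQuotient := by
    obtain ⟨τ, hτ⟩ := UnitaryGroup.exists_infinitePlace_ne L hdeg ι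
    exact UnitaryGroup.compactSpace_adelicGroupData_automorphicQuotient L 2 H
      (UnitaryGroup.anisotropic_of_formCongr_smul_eq_of_posDef L 2 H dV t ht g hg τ (hdef τ hτ))
  have hT : Continuous ιA ∧ ∀ ⦃γ : (adelicGroupData (↥(maximalRealSubfield L)) L (IsCMField.complexConj L) 2 H).Adelic⦄,
      γ ∈ (UnitaryGroup.toAdelic (↥(maximalRealSubfield L)) L (IsCMField.complexConj L) 2 H).range →
        ιA γ ∈ (UnitaryGroup.toAdelic (↥(maximalRealSubfield L)) L (IsCMField.complexConj L) 2 (Matrix.diagonal dV)).range :=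
    ⟨continuous_of_pin L 2 H dV g ιA hιA, fun γ hγ => mem_range_toAdelic_of_pin L 2 H dV t ht g hg ιA hιA hγ⟩
  -- (A) every Hermite-slice class `[θ_{h_β′ ⊗ Φ_f}]` lies in `Q` (C∞)
  have hA : ∀ β' : ((Fin n' × {v : InfinitePlace (↥(maximalRealSubfield L)) // v.IsReal}) →₀ ℕ),
      MemLp.toLp _ (memLp_toQuotFun_lineThetaLift L 2 H e₁ dV hdV hdV0 ιA hT lam hlam a' hρ μW
            (piSchwartzBruhatEquiv (↥(maximalRealSubfield L)) (Fin n') (follandHermite (frameV L e₁ dV hdV hdV0 (lineW L (TW (Fp L) a')) (complexConj_lineW L (TW (Fp L) a'))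
                (lineW_ne_zero L (TW (Fp L) a') (isUnit_det_TW (Fp L) a'))) β' ⊗ₜ[ℂ] Φf)) (charCM ξ) μ 2) ∈ Q :=
    fun β' => hAL L ι H dV hdV hdV0 t ht g hg hsig hdef hdeg μ e₁ lam hlam hw ιA hιA a' ξ hρ μW β Φf hw0 Q hwQ β'
  -- (B) every pure-tensor class `[θ_{φ ⊗ Φ_f}]` lies in `Q` (Hermite expansion, `Q` closed)
  have hB : ∀ φ : 𝓢((Fin n' → mixedEmbedding.mixedSpace ↥(maximalRealSubfield L)), ℂ),
      MemLp.toLp _ (memLp_toQuotFun_lineThetaLift L 2 H e₁ dV hdV hdV0 ιA hT lam hlam a' hρ μW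
            (piSchwartzBruhatEquiv (↥(maximalRealSubfield L)) (Fin n') (φ ⊗ₜ[ℂ] Φf)) (charCM ξ) μ 2) ∈ Q := by
    intro φ
    obtain ⟨c, hc⟩ := hHS L ι H dV hdV hdV0 t ht g hg hsig hdef hdeg μ e₁ lam hlam hw ιA hιA a' ξ hρ μW φ Φf
    exact Q.isClosed.mem_of_tendsto hc (Filter.Eventually.of_forall fun s =>
      Q.toSubmodule.sum_mem fun β' _ => Q.toSubmodule.smul_mem (c β') (hA β'))
  -- (C) every pure-tensor class `[θ_{φ ⊗ Φ_f′}]` lies in `Q` (Cf)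
  have hC : ∀ (φ : 𝓢((Fin n' → mixedEmbedding.mixedSpace ↥(maximalRealSubfield L)), ℂ)) (Φf' : FinSB (↥(maximalRealSubfield L)) (Fin n')),
      MemLp.toLp _ (memLp_toQuotFun_lineThetaLift L 2 H e₁ dV hdV hdV0 ιA hT lam hlam a' hρ μW
            (piSchwartzBruhatEquiv (↥(maximalRealSubfield L)) (Fin n') (φ ⊗ₜ[ℂ] Φf')) (charCM ξ) μ 2) ∈ Q :=
    fun φ Φf' => hFG L ι H dV hdV hdV0 t ht g hg hsig hdef hdeg μ e₁ lam hlam hw ιA hιA a' ξ hρ μW β Φf hw0 Q φ (hB φ) Φf'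
  -- (D) every class `[θ^{μ_W}_Ψ′]` lies in `Q` (pure tensors span, linearity)
  have hD : ∀ Ψ' : piSchwartzBruhat (↥(maximalRealSubfield L)) (Fin n'),
      MemLp.toLp _ (memLp_toQuotFun_lineThetaLift L 2 H e₁ dV hdV hdV0 ιA hT lam hlam a' hρ μW
            (Ψ') (charCM ξ) μ 2) ∈ Q := by
    intro Ψ'
    obtain ⟨t', rfl⟩ := (piSchwartzBruhatEquiv (↥(maximalRealSubfield L)) (Fin n')).surjective Ψ'
    induction t' using TensorProduct.induction_on with
    | zero =>
      rw [toLp_lineThetaLift_congr L 2 H e₁ dV hdV hdV0 ιA hT lam hlam a' hρ μW (charCM ξ) μ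
        (show piSchwartzBruhatEquiv (↥(maximalRealSubfield L)) (Fin n') 0 =
            (0 : ℂ) • piSchwartzBruhatEquiv (↥(maximalRealSubfield L)) (Fin n') 0 by rw [map_zero, smul_zero]),
        F0LD2ThetaTensorClasses.toLp_lineThetaLift_smul_left (hιA := hT), zero_smul]
      exact Q.toSubmodule.zero_mem
    | tmul φ Φf' => exact hC φ Φf'
    | add x y hx hy =>
      rw [toLp_lineThetaLift_congr L 2 H e₁ dV hdV hdV0 ιA hT lam hlam a' hρ μW (charCM ξ) μ (map_add _ x y),
        F0LD2ThetaTensorClasses.toLp_lineThetaLift_add_left (hιA := hT)]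
      exact Q.toSubmodule.add_mem hx hy
  -- (E) the other theta datum `(hρ′, μ_W′)` ((Gβ-M), witness `w ≠ 0`)
  obtain ⟨c, hc⟩ := hM L ι H dV hdV hdV0 t ht g hg hsig hdef hdeg μ e₁ lam hlam hw ιA hιA a' ξ hρ hρ' μW μW' ⟨_, hw0⟩
  rw [hc Ψ]
  exact Q.toSubmodule.smul_mem c (hD Ψ)

/-- **ORGAN (Gα) FROM THE SIX LOCAL BRICKS** — `ThetaDichotomy₂ ⇐ HermiteSum → TorusProjector → FiniteLevel → MeasureScaling → ArchLadder → FinGeneration`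
(★ `thetaDichotomy₂_of_bricks` ∘ `sliceCyclic_of_bricks`); with ★ `thetaSlice₂_of_bricks` BOTH organs of the (I′) germ road are consequences of the six bricks.
[cite: Dixmier1977, §13.1.2] [cite: MoeglinVignerasWaldspurger1987, Chap. 3 IV.4] -/
theorem thetaDichotomy₂_of_localBricks (hHS : HermiteSum) (hP : TorusProjector) (hL : FiniteLevel) (hM : MeasureScaling)
    (hAL : ArchLadder) (hFG : FinGeneration) : ThetaDichotomy₂ :=
  thetaDichotomy₂_of_bricks hHS hP hL hM (sliceCyclic_of_bricks hHS hM hAL hFG)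

end Summit.HodgeConjecture.HodgeConjecture.Cruxes.HLiu418.F0LD1ThetaDichotomyOfBricks

end
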